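import Summits.QuantumFields.BalabanUV.Beta.GAN24.OneStepConstraintAxialVolumeLimit
import Summits.QuantumFields.BalabanUV.Beta.GAN24.OneStepConstraintAxialDelK
import Summits.QuantumFields.BalabanUV.Beta.GAN24.DirichletExhaustionDeperiodise

/-!
# `BalabanUV.Beta.GAN24.OneStepConstraintAxialDelKVolumeLimit` — binder row G-an2-4 ∕ (CONV-C), routes C-R6° («VALUES») × R7 («TWO CURRENCIES») × pv09's B6 torus line × road P2's
# periodisation, PART 190: THE GAUGE-FIXED ONE-LOOP LETTER `𝒢_n = flucCov(re Δ_n, Q_ax)` HAS AN INFINITE-VOLUME LIMIT ENTRY BY ENTRY (EL₂), EVERY LEVEL `n ≥ 1`, EVERY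
# DIMENSION `d + 1 ≥ 2`, ALONG EVERY CUBIC VOLUME SEQUENCE — NO RESIDUAL HYPOTHESIS.  Two inputs beyond PARTs 185–189: (1) the volume limit of `re Δ_n` itself, which is NOT
# taken from an5's fine propagator (`d ≥ 3`, even volumes) but from road P2's periodisation identity — pv09's torus matrix `deltaPol M n` of the (1.66) form IS the periodisation
# `Σ_m deltaZ(· + M∘m)` of the `ℤ^{d+1}` kernel (PART 12 `deltaPol_eq_tsum_deltaZ`), whose wrap-around tails are `O(e^{−κ_Z(min_i M_i − 1)})` (PART 20 `abs_tsum_translate_sub_le`) —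
# so `re Δ_n(ŵ′, ŵ) → deltaZ n 1 (w′ − w)` along ANY period vectors `M → ∞`, with the limit NAMED; (2) PART 181's discharge of every letter of PART 189 for `H = re Δ_n`
# (symmetry, positivity, pv15's kernel decay read in the block distance, pv09's (2.153) coercivity, b05's profile).  Census V201′ (ε) CLOSED for `𝒢_n` at fine readings
# (unit b2b-balaban-gan24-p3, gen 61; v1)

NOT IN PRINT; OUR PROOF ([folklore] bookkeeping BY NAME over road P2's `DirichletExhaustionPeriodise.deltaPol_eq_tsum_deltaZ` ∕ `DirichletExhaustionDeperiodise` (`exists_rep_toT_eq_translate`,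
`tsum_translate_translate`, `deltaZ_eq_sub`, `abs_mul_deltaZ_col_le`, `abs_tsum_translate_sub_le`, `tendsto_exp_tail`), leaf-03's `AveragedPropagatorInverseUniform` (`DelK_apply`,
`exists_DelK_kernel_decay`), pv09's `B6Cov2156TorusDelK.idxEquiv_symm_apply` ∕ `gamma2153one_pos`, PART 181 `OneStepConstraintAxialDelK` (`coercive_reg_DelK_axial_of_ub`, `abs_reDelK_le_par`) ∕
`OneStepConstraintAxialCoercivity` (`reDelK_transpose`, `dotProduct_reDelK_nonneg`) ∕ `OneStepConstraintBlockGeometry.form_le_of_entry_decay_par`, PART 186 `cpt_castT_add_off`, PART 189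
`tendsto_flucCov_rho`, b05's `VectorTailsCov.sum_exp_tdist_le`; [Balaban1984PropagatorsI] (1.66) p. 29, [Balaban1984PropagatorsII] (2.152)–(2.157) pp. 249–250, [Balaban1987RG1] p. 264 (after (1.21))
LOCATE the objects and the `T ↗ ℤ^d` limit; nothing printed is a hypothesis).
HONEST FRAMING (cell contract, verbatim): «discharging `BetaPertH` makes Bałaban's UV stability UNCONDITIONAL — a real constructive-QFT result; it is NOT the
continuum limit and NOT the Clay problem.»  HONEST DEPENDENCY (verbatim): «continuum YM on T⁴ ⇐ BetaPertH ∧ nine spine estimates (0/9 proved); BetaPertH ⇐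
(D1) ∧ (D4) ∧ CAP+tail; G-an2-4 gates asym, D1 and NE2/3/4.»

WHAT THIS FILE PROVES (0 sorry, 0 `def`):
* §1 **`deltaPol_rep_rep_eq_tsum`** — at box representatives of integer readings `w′, w`: `deltaPol M (L^k) ((rep ŵ′, κ), (rep ŵ, l)) = Σ'_m deltaZ L k ((w′ − w) + M∘m, κ) (0, l)` (PART 12 at
  two arbitrary points, by translation invariance of `deltaZ`).
* §2 **`tendsto_deltaPol_rep`** — along ANY period vectors `M_t` with `min_i M_t i → ∞`: `deltaPol M_t (L^k) ((rep ŵ′,κ),(rep ŵ,l)) → deltaZ L k (w′ − w, κ) (0, l)` (the NAMED limit);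
  **`tendsto_reDelK_castT`** — the same for `re Δ_n(ŵ′, ŵ)`, every `n ≥ 1`, every `a > 0` (leaf-03's `DelK_apply`).
* §3 **`exists_tendsto_flucCov_DelK_axial`** — in dimension `d + 1 ≥ 2`, for every blocking factor `Lb ≥ 1`, all `a, a′ > 0`, every level `n ≥ 1` and every cubic coarse volume sequence
  `s t → ∞`: for all fine readings `(z,f), (z′,f′)` (block coordinate `z ∈ ℤ^{d+1}`, offset-direction `f`), `∃ c, flucCov (re Δ_n) (fromRows (re QB 1 Lb M_t) E_tree) (ρ(ẑ,f)) (ρ(ẑ′,f′)) → c` —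
  EL₂ of the gauge-fixed one-loop fluctuation covariance of PARTs 181–184 (an2's `CompositionSingular.flucCov`; Bałaban's `C(C*Δ_kC)⁻¹C*` of (2.156)), NO RESIDUAL HYPOTHESIS.
WHAT IT IS NOT: the limit of `𝒢_n` is not named here (it exists entrywise); no rate in the volume; the loop contraction (ζ) and EL₂ of `𝒮_n`, `ℋ_n` separately (θ) are not here; `U = 1`,
first-order MODEL framing unchanged.  SUPPLIER work; NEVER «G-an2-4 closed»; NOT (CONV-C), NOT D1, NOT `BetaPertH`, NOT continuum, NOT Clay.  Records: `HOME/b2b-balaban-gan24-p3/gen61/README.md`.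
-/

noncomputable section

open scoped BigOperators ComplexConjugate Matrix
open Filter Topology Finset Matrix

namespace Summit.QuantumFields.BalabanUV.Beta.GAN24.OneStepConstraintAxialDelKVolumeLimit

open Literature.MathematicalPhysics.QuantumFieldTheory.Balaban1983to89
open Literature.MathematicalPhysics.QuantumFieldTheory.Balaban1983to89.B4Sect5Proof (latticeConst latticeConst_nonneg)
open Literature.MathematicalPhysics.QuantumFieldTheory.Balaban1983to89.B4TorusKernel.MultiPeriod (translate translate_apply)
open Literature.MathematicalPhysics.QuantumFieldTheory.Balaban1983to89.B5Prop11Plancherel (Tor fine)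
open Literature.MathematicalPhysics.QuantumFieldTheory.Balaban1983to89.B5RealFields (reM reM_apply)
open Literature.MathematicalPhysics.QuantumFieldTheory.Balaban1983to89.B5G183RateTorus (cpt)
open Literature.MathematicalPhysics.QuantumFieldTheory.Balaban1983to89.B5G183RateTorusW (off)
open Literature.MathematicalPhysics.QuantumFieldTheory.Balaban1983to89.Beta.FreeLegDictionary (cubic)
open Literature.MathematicalPhysics.QuantumFieldTheory.Balaban1983to89.Beta.VectorTails (castT)
open Literature.MathematicalPhysics.QuantumFieldTheory.Balaban1983to89.Beta.VectorTailsCov (tdist sum_exp_tdist_le)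
open Literature.MathematicalPhysics.QuantumFieldTheory.Balaban1983to89.Beta.CompositionSingular (flucCov)
open Literature.MathematicalPhysics.QuantumFieldTheory.Balaban1983to89.Beta.BlockEffectiveAction (DelK)
open Literature.MathematicalPhysics.QuantumFieldTheory.Balaban1983to89.B6Lemma24Torus (pbox)
open Literature.MathematicalPhysics.QuantumFieldTheory.Balaban1983to89.B6LowerBound2153Torus (toT rep rep_mem_pbox)
open Literature.MathematicalPhysics.QuantumFieldTheory.Balaban1983to89.B6Cov2156Torus (deltaPol)
open Literature.MathematicalPhysics.QuantumFieldTheory.Balaban1983to89.B6Cov2156TorusDelK (idxEquiv idxEquiv_symm_apply gamma2153one gamma2153one_pos)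
open Summit.QuantumFields.BalabanUV.T4Continuum.BalabanLineAverage (QB)
open Summit.QuantumFields.BalabanUV.T4Continuum.BalabanAveragedTowerModes (par rem)
open Summit.QuantumFields.BalabanUV.Beta.GAN24.DirichletExhaustionDeltaZ (deltaZ c166Z kappaZ kappaZ_pos)
open Summit.QuantumFields.BalabanUV.Beta.GAN24.DirichletExhaustionPeriodise (deltaPol_eq_tsum_deltaZ)
open Summit.QuantumFields.BalabanUV.Beta.GAN24.DirichletExhaustionDeperiodise (exists_rep_toT_eq_translate tsum_translate_translate deltaZ_eq_sub abs_mul_deltaZ_col_le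
  abs_tsum_translate_sub_le tendsto_exp_tail)
open Summit.QuantumFields.BalabanUV.Beta.GAN24.AveragedPropagatorInverseUniform (DelK_apply exists_DelK_kernel_decay)
open Summit.QuantumFields.BalabanUV.Beta.GAN24.OneStepConstraintAxialCoercivity (reDelK_transpose dotProduct_reDelK_nonneg)
open Summit.QuantumFields.BalabanUV.Beta.GAN24.OneStepConstraintBlockGeometry (form_le_of_entry_decay_par)
open Summit.QuantumFields.BalabanUV.Beta.GAN24.OneStepConstraintAxialDelK (coercive_reg_DelK_axial_of_ub abs_reDelK_le_par)
open Summit.QuantumFields.BalabanUV.Beta.GAN24.OneStepConstraintBlockPresentation (tree_cpt_add_off cpt_castT_add_off)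
open Summit.QuantumFields.BalabanUV.Beta.GAN24.OneStepConstraintAxialVolumeLimit (tendsto_flucCov_rho)

variable {d : ℕ}

/-! ## §1 PART 12 at two arbitrary integer readings -/

section Periodisation

variable (M : Fin (d + 1) → ℕ) [hM : ∀ μ, NeZero (M μ)]

/-- **`deltaPol_rep_rep_eq_tsum`** — for integer readings `w′, w ∈ ℤ^{d+1}` and directions `κ, l`:
`deltaPol M (L^k) ((rep ŵ′, κ), (rep ŵ, l)) = Σ'_m deltaZ L k ((w′ − w) + M∘m, κ) (0, l)` (road P2's PART 12 `deltaPol_eq_tsum_deltaZ`, the box representatives being translates of the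
readings, translation invariance of `deltaZ`, re-indexing `m ↦ s₁ − s₂ − m`). [folklore] -/
theorem deltaPol_rep_rep_eq_tsum (L : ℕ) [NeZero L] (k : ℕ) (κ l : Fin (d + 1)) (w' w : Fin (d + 1) → ℤ) :
    deltaPol M (L ^ k) (⟨rep M (toT M w'), rep_mem_pbox M _⟩, κ) (⟨rep M (toT M w), rep_mem_pbox M _⟩, l) =
      ∑' m : Fin (d + 1) → ℤ, deltaZ L k (translate M (w' - w) m, κ) (0, l) := by
  obtain ⟨s₁, hs₁⟩ := exists_rep_toT_eq_translate M w'
  obtain ⟨s₂, hs₂⟩ := exists_rep_toT_eq_translate M w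
  rw [deltaPol_eq_tsum_deltaZ M L k]
  change ∑' m : Fin (d + 1) → ℤ, deltaZ L k (rep M (toT M w'), κ) (translate M (rep M (toT M w)) m, l) = _
  rw [hs₁, hs₂]
  have hrew : ∀ m, deltaZ L k (translate M w' s₁, κ) (translate M (translate M w s₂) m, l) = deltaZ L k (translate M (w' - w) (s₁ - s₂ - m), κ) (0, l) := by
    intro m
    rw [deltaZ_eq_sub, deltaZ_eq_sub L k (translate M (w' - w) (s₁ - s₂ - m))]
    congr 2
    funext i; simp only [Pi.sub_apply, translate_apply, Pi.zero_apply]; ring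
  simp only [hrew]
  exact (Equiv.subLeft (s₁ - s₂)).tsum_eq fun m => deltaZ L k (translate M (w' - w) m, κ) (0, l)

end Periodisation

/-! ## §2 The volume limit of the (1.66) torus matrix and of `re Δ_n` at integer readings -/

section Limit

variable (Mv : ℕ → Fin (d + 1) → ℕ) [hMv0 : ∀ t μ, NeZero (Mv t μ)]

/-- **`tendsto_deltaPol_rep` — THE (1.66) TORUS MATRIX CONVERGES TO THE `ℤ^{d+1}` KERNEL**: along period vectors `M_t` with `min_i M_t i → ∞`, for every `L ≥ 1`, `k` and all readings,
`deltaPol M_t (L^k) ((rep ŵ′,κ),(rep ŵ,l)) → deltaZ L k (w′ − w, κ) (0, l)` (§1 + road P2's tail bound `abs_tsum_translate_sub_le` with PART 8's decay of `deltaZ`). [folklore] -/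
theorem tendsto_deltaPol_rep (hMv : ∀ Nb : ℕ, ∀ᶠ t in atTop, ∀ i, Nb ≤ Mv t i) (L : ℕ) [NeZero L] (k : ℕ) (κ l : Fin (d + 1)) (w' w : Fin (d + 1) → ℤ) :
    Tendsto (fun t => deltaPol (Mv t) (L ^ k) (⟨rep (Mv t) (toT (Mv t) w'), rep_mem_pbox (Mv t) _⟩, κ) (⟨rep (Mv t) (toT (Mv t) w), rep_mem_pbox (Mv t) _⟩, l))
      atTop (𝓝 (deltaZ L k (w' - w, κ) (0, l))) := by
  have hc : 0 ≤ c166Z d := by have := B5Symbol166Strip.MG_pos (d + 1); unfold c166Z; positivity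
  have hf : ∀ v : Fin (d + 1) → ℤ, |deltaZ L k (v, κ) (0, l)| ≤ c166Z d * Real.exp (-(kappaZ d * dist (0 : Fin (d + 1) → ℤ) v)) := fun v => by
    have h := abs_mul_deltaZ_col_le L k κ l 1 v
    simp only [one_mul, abs_one] at h
    exact h
  rw [Metric.tendsto_nhds]
  intro ε hε
  -- choose the window size `Nb` with tail `< ε`
  have htail := ((tendsto_exp_tail (kappaZ_pos d)).const_mul (c166Z d * latticeConst (d + 1) (kappaZ d) * Real.exp (kappaZ d * dist (0 : Fin (d + 1) → ℤ) (w' - w))))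
  rw [mul_zero] at htail
  obtain ⟨Nb, hNb⟩ := ((htail.eventually (gt_mem_nhds hε)).and (eventually_ge_atTop 1)).exists
  obtain ⟨hNbε, hNb1⟩ := hNb
  filter_upwards [hMv Nb] with t ht
  rw [deltaPol_rep_rep_eq_tsum, Real.dist_eq]
  exact lt_of_le_of_lt (abs_tsum_translate_sub_le (kappaZ_pos d) hc hf hNb1 ht (w' - w)) hNbε

/-- **`tendsto_reDelK_castT` — THE VOLUME LIMIT OF `re Δ_n` AT INTEGER READINGS, NAMED**: along period vectors `M_t → ∞`, for every `n ≥ 1`, `a > 0`, all `w′, w, κ, l`: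
`re Δ_n((ŵ′,κ),(ŵ,l)) → deltaZ n 1 (w′ − w, κ) (0, l)` (leaf-03's `DelK_apply`: the entries of `Δ_n` are those of `deltaPol M n` on box representatives). [folklore] -/
theorem tendsto_reDelK_castT (hMv : ∀ Nb : ℕ, ∀ᶠ t in atTop, ∀ i, Nb ≤ Mv t i) (n : ℕ) [NeZero n] (hn : 1 ≤ n) (a : ℝ) (ha : 0 < a) (κ l : Fin (d + 1))
    (w' w : Fin (d + 1) → ℤ) :
    Tendsto (fun t => reM (DelK n hn (Mv t) a ha) (castT (Mv t) w', κ) (castT (Mv t) w, l)) atTop (𝓝 (deltaZ n 1 (w' - w, κ) (0, l))) := by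
  have h := tendsto_deltaPol_rep Mv hMv n 1 κ l w' w
  rw [pow_one] at h
  refine h.congr fun t => ?_
  rw [reM_apply, DelK_apply, Complex.ofReal_re, idxEquiv_symm_apply, idxEquiv_symm_apply]
  rfl

end Limit

/-! ## §3 The gauge-fixed one-loop letter `𝒢_n = flucCov(re Δ_n, Q_ax)` has EL₂ at fine readings -/

section Assembled

variable (Lb : ℕ) [NeZero Lb] (n : ℕ) [NeZero n] (hn : 1 ≤ n) (a : ℝ) (ha : 0 < a) (s : ℕ → ℕ) [hs0 : ∀ t, NeZero (s t)]

/-- **`exists_tendsto_flucCov_DelK_axial` — EL₂ OF THE GAUGE-FIXED ONE-LOOP FLUCTUATION COVARIANCE, NO RESIDUAL HYPOTHESIS**: in dimension `d + 1 ≥ 2`, for every blocking factor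
`Lb ≥ 1`, all dummies `a, a′ > 0`, every level `n ≥ 1` and every cubic coarse volume sequence `s t → ∞`, the entries of `𝒢_n = flucCov (re Δ_n) (fromRows (re QB 1 Lb M_t) E_tree)`
(`M_t = cubic (d+1) (s t)`; an2's `CompositionSingular.flucCov`; Bałaban's `C(C*Δ_kC)⁻¹C*` of (2.156)) at fine readings `ρ(ẑ,f) = (Lb·ẑ + j, μ)` (`f = (j,μ)`) CONVERGE:
`∀ f f′ z z′, ∃ c, 𝒢_{n,t}(ρ(ẑ,f), ρ(ẑ′,f′)) → c` — PART 189 `tendsto_flucCov_rho` with every letter discharged as in PART 181 and EL₂ of `re Δ_n` from §2. [folklore] -/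
theorem exists_tendsto_flucCov_DelK_axial (hd : 1 ≤ d) (hs : Tendsto s atTop atTop) {a' : ℝ} (ha' : 0 < a')
    (f f' : (Fin (d + 1) → Fin Lb) × Fin (d + 1)) (z z' : Fin (d + 1) → ℤ) :
    ∃ c : ℝ, Tendsto (fun t => flucCov (reM (DelK n hn (fine (Lb * 1) (cubic (d + 1) (s t))) a ha)) (Matrix.fromRows (reM (QB 1 Lb (cubic (d + 1) (s t)))) (fun (t' : {x : Tor (fine (Lb * 1) (cubic (d + 1) (s t))) × Fin (d + 1) // (∀ ν, ν < x.2 → ((rem 1 Lb (cubic (d + 1) (s t)) x.1 ν : ℕ)) = 0) ∧ ((rem 1 Lb (cubic (d + 1) (s t)) x.1 x.2 : ℕ)) + 1 < Lb}) (x : Tor (fine (Lb * 1) (cubic (d + 1) (s t))) × Fin (d + 1)) => if x = (Function.Embedding.subtype (fun x : Tor (fine (Lb * 1) (cubic (d + 1) (s t))) × Fin (d + 1) => (∀ ν, ν < x.2 → ((rem 1 Lb (cubic (d + 1) (s t)) x.1 ν : ℕ)) = 0) ∧ ((rem 1 Lb (cubic (d + 1) (s t)) x.1 x.2 : ℕ))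 + 1 < Lb)) t' then (1 : ℝ) else 0)) ((cpt 1 Lb (cubic (d + 1) (s t)) ((castT (fine 1 (cubic (d + 1) (s t))) z)) + off 1 Lb (cubic (d + 1) (s t)) (f).1, (f).2) : Tor (fine (Lb * 1) (cubic (d + 1) (s t))) × Fin (d + 1)) ((cpt 1 Lb (cubic (d + 1) (s t)) ((castT (fine 1 (cubic (d + 1) (s t))) z')) + off 1 Lb (cubic (d + 1) (s t)) (f').1, (f').2) : Tor (fine (Lb * 1) (cubic (d + 1) (s t))) × Fin (d + 1))) atTop (𝓝 c) := by
  have hd' : 1 ≤ d + 1 := by omega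
  have hd2 : 2 ≤ d + 1 := by omega
  have hLb : (1 : ℝ) ≤ Lb := by exact_mod_cast Nat.one_le_iff_ne_zero.2 (NeZero.ne Lb)
  -- the d-only kernel decay of `Δ_k`
  obtain ⟨c₀, δ₀, hc₀, hδ₀, hker⟩ := exists_DelK_kernel_decay (d := d)
  -- the volume-uniform site profile
  have hex : ∀ s' : ℝ, ∃ S : ℝ, 0 ≤ S ∧ (0 < s' → ∀ (N : Fin (d + 1) → ℕ) [∀ μ, NeZero (N μ)] (y : (μ : Fin (d + 1)) → ZMod (N μ)),
      ∑ y', Real.exp (-(s' * (tdist y y' : ℝ))) ≤ S) := by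
    intro s'
    by_cases hs' : 0 < s'
    · obtain ⟨S, hS0, hS⟩ := sum_exp_tdist_le (d := d + 1) hd2 hs'
      exact ⟨S, hS0, fun _ => hS⟩
    · exact ⟨0, le_rfl, fun h => absurd h hs'⟩
  choose Kf hKf0' hKf' using hex
  have hKf0 : ∀ s' : ℝ, 0 < s' → 0 ≤ Kf s' := fun s' _ => hKf0' s'
  have hh₀0 : 0 ≤ c₀ * Real.exp (δ₀ * ((Lb : ℝ) - 1)) := by positivity
  have hδH0 : 0 < δ₀ * Lb := by positivity
  have hγ₀ : 0 < gamma2153one (d + 1) (Lb * 1) := gamma2153one_pos (by omega) (Nat.one_le_iff_ne_zero.2 (NeZero.ne (Lb * 1)))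
  have hHent : ∀ t (x x' : Tor (fine (Lb * 1) (cubic (d + 1) (s t))) × Fin (d + 1)), |reM (DelK n hn (fine (Lb * 1) (cubic (d + 1) (s t))) a ha) x x'| ≤
      c₀ * Real.exp (δ₀ * ((Lb : ℝ) - 1)) * Real.exp (-(δ₀ * Lb * (tdist (par 1 Lb (cubic (d + 1) (s t)) x.1) (par 1 Lb (cubic (d + 1) (s t)) x'.1) : ℝ))) :=
    fun t x x' => abs_reDelK_le_par Lb n hn a ha (cubic (d + 1) (s t)) hc₀.le hδ₀.le (fun q' q => hker n hn (fine (Lb * 1) (cubic (d + 1) (s t))) a ha q' q) x x'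
  have hh0 : 0 ≤ c₀ * Real.exp (δ₀ * ((Lb : ℝ) - 1)) * ((((d + 1 : ℕ) : ℝ)) * (Lb : ℝ) ^ (d + 1) * Kf (δ₀ * Lb)) := by have := hKf0' (δ₀ * Lb); positivity
  have hHub : ∀ t (u : Tor (fine (Lb * 1) (cubic (d + 1) (s t))) × Fin (d + 1) → ℝ), u ⬝ᵥ (reM (DelK n hn (fine (Lb * 1) (cubic (d + 1) (s t))) a ha) *ᵥ u) ≤
      c₀ * Real.exp (δ₀ * ((Lb : ℝ) - 1)) * ((((d + 1 : ℕ) : ℝ)) * (Lb : ℝ) ^ (d + 1) * Kf (δ₀ * Lb)) * (u ⬝ᵥ u) :=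
    fun t u => form_le_of_entry_decay_par 1 Lb (cubic (d + 1) (s t)) (reDelK_transpose Lb (cubic (d + 1) (s t)) n hn a ha) (fun s' hs' y => hKf' s' hs' _ y) hh₀0 hδH0 (hHent t) u
  refine tendsto_flucCov_rho 1 Lb s hd' hs hKf0 (fun s' hs' t y => hKf' s' hs' _ y) (fun t => reDelK_transpose Lb (cubic (d + 1) (s t)) n hn a ha)
    (fun t => dotProduct_reDelK_nonneg Lb (cubic (d + 1) (s t)) n hn a ha) ha' hh₀0 hδH0
    (inv_pos.mpr (lt_of_lt_of_le (div_pos four_pos hγ₀) (le_max_left _ _))) hHent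
    (fun t => coercive_reg_DelK_axial_of_ub Lb (cubic (d + 1) (s t)) n hn a ha hd2 hh0 (hHub t) ha') (fun f₁ f₁' u u' => ?_) f f' z z'
  -- EL₂ of `re Δ_n` at fine readings: the reading `ρ(û,(j,μ))` is the integer reading `(Lb·u + j)^` (PART 186), and §2 applies along `M_t = fine (Lb·1) (cubic (s t))`
  have hMv : ∀ Nb : ℕ, ∀ᶠ t in atTop, ∀ i : Fin (d + 1), Nb ≤ fine (Lb * 1) (cubic (d + 1) (s t)) i := by
    intro Nb
    filter_upwards [hs.eventually_ge_atTop Nb] with t ht i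
    exact ht.trans (Nat.le_mul_of_pos_left _ (Nat.pos_of_ne_zero (NeZero.ne (Lb * 1))))
  refine ⟨_, (tendsto_reDelK_castT (fun t => fine (Lb * 1) (cubic (d + 1) (s t))) hMv n hn a ha f₁.2 f₁'.2
    (fun ν => (Lb : ℤ) * u ν + ((f₁.1 ν : ℕ) : ℤ)) (fun ν => (Lb : ℤ) * u' ν + ((f₁'.1 ν : ℕ) : ℤ))).congr fun t => ?_⟩
  rw [cpt_castT_add_off, cpt_castT_add_off]

end Assembled

end Summit.QuantumFields.BalabanUV.Beta.GAN24.OneStepConstraintAxialDelKVolumeLimit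

end
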